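import Mathlib.Analysis.Normed.Module.MultipliableUniformlyOn
import Mathlib.Analysis.Complex.LocallyUniformLimit
import Mathlib.Analysis.Calculus.IteratedDeriv.Lemmas
import Mathlib.Analysis.SpecialFunctions.ExpDeriv
import Literature.Barriers.CriticalPhenomena.RigorousRGSmallParameterHHWNewmanBounds
import Literature.Barriers.CriticalPhenomena.RigorousRGSmallParameterHHWNewman
import HarnessLib

/-!
# Newman's bound (A.6) — `HaraHattoriWatanabe2001_eqA6` discharged

Sibling proof file of `RigorousRGSmallParameterHHWNewmanBounds.lean`, which vendors HHW, Appendix A,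
Proposition A.1, eq. (A.6) — `a_{M+N} ≤ a_M a_N` for `a_N = N!/(2N)! · E[X^{2N}]`, `X ~ h_N = R^N h_{I,s}`
— as the named fact `HaraHattoriWatanabe2001_eqA6`. Here it is PROVED, following the printed proof
(HHW p. 21–22):

* (A.7) `E[e^{HX}] = e^{bH²} ∏_j (1 + H² y_j)`, `y_j = α_j⁻² > 0`, `Σ y_j < ∞`: the tree's
  `HierarchicalRG.exists_newmanRepr_iterate` (file `…HHWNewman.lean`, from Hadamard's genus-zero
  factorisation and the Lee–Yang property) gives this for `h_N` with `b = 0` (no Gaussian factor), for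
  every `0 < c ≤ 2`, `s ≥ 0`;
* (A.8)–(A.9) `∏_j (1 + H² y_j) = Σ_n c_n H^{2n}/n!`, `c_n = Σ'` over non-coinciding ordered indices
  `= n! · e_n(y)` with `e_n` the elementary symmetric function: for a FINITE subfamily `F` (where
  `e_n(F) = ∑ S ∈ F.powersetCard n, ∏ j ∈ S, y j`) this is
  `HierarchicalRG.prod_one_add_mul_sq` / `iteratedDeriv_prod_one_add_mul_sq`;
  the passage to the infinite family is by locally uniform convergence of the partial products on the
  unit disc (Mathlib's `Summable.hasProdLocallyUniformlyOn_one_add`) and of all their derivatives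
  (`TendstoLocallyUniformlyOn.deriv`), so that `(2n)! e_n(F) → (d/dH)^{2n} E[e^{HX}]|₀ = E[X^{2n}]`
  along `F → ∞` (`tendsto_factorial_mul_esymm_iteratedDeriv`, `iteratedDeriv_expSum`);
* (A.11) `c_{n+m} ≤ c_n c_m` ("the conditions of primed summations are weaker for the left hand
  side"): `factorial_mul_esymm_add_le`, by induction on the finite family (adjoining one `y_a ≥ 0`
  replaces `c_n` by `c_n + n y_a c_{n-1}`, which preserves sub-multiplicativity: `submult_of_succ_eq`);
* (A.10), (A.12) (the binomial convolution with the Gaussian coefficients `b^N`) are not needed since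
  `b = 0`: `a_N = c_N = lim_F c_N(F)` and (A.6) is the limit of (A.11)
  (`taylorA_iterate_add_le`, general `0 < c ≤ 2`; `HaraHattoriWatanabe2001_eqA6_holds`, `c = √2`).

## References

* T. Hara, T. Hattori, H. Watanabe, *Triviality of hierarchical Ising model in four dimensions*,
  Comm. Math. Phys. 220 (2001) 13–40, Appendix A, Proposition A.1, eqs. (A.6)–(A.12) (PDF pp. 21–22).
* C. M. Newman, *Inequalities for Ising models and field theories which obey the Lee–Yang theorem*,
  Comm. Math. Phys. 41 (1975) 1–9, Theorem 6.
-/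

noncomputable section

namespace Literature.Barriers.CriticalPhenomena

open _root_.MeasureTheory _root_.ProbabilityTheory _root_.Filter _root_.Set _root_.Finset
open scoped _root_.Topology BigOperators

namespace HierarchicalRG

/-! ### (A.9), (A.11): elementary symmetric sums of finitely many `y_j ≥ 0`

For a finite subfamily `F` of the `y_j` write `e_n(F) = Σ_{S ⊆ F, #S = n} ∏_{j ∈ S} y_j`
(`∑ S ∈ F.powersetCard n, ∏ j ∈ S, y j`, the `n`-th elementary symmetric function); HHW's primed
sum (A.9) over non-coinciding ORDERED indices drawn from `F` is `c_n(F) = n! · e_n(F)`. -/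

section Esymm

variable {ι : Type*}

/-- `e_0(F) = 1`. [cite: HaraHattoriWatanabe2001, Appendix A eq. (A.8)] -/
theorem esymm_powersetCard_zero (y : ι → ℝ) (F : Finset ι) :
    ∑ S ∈ F.powersetCard 0, ∏ j ∈ S, y j = 1 := by
  simp [Finset.powersetCard_zero]

/-- `e_{n+1}(∅) = 0`. [folklore] -/
theorem esymm_powersetCard_empty_succ (y : ι → ℝ) (n : ℕ) :
    ∑ S ∈ (∅ : Finset ι).powersetCard (n + 1), ∏ j ∈ S, y j = 0 := by
  have h : (∅ : Finset ι).powersetCard (n + 1) = ∅ :=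
    Finset.powersetCard_eq_empty.2 (by simp)
  simp [h]

/-- `e_n(F) ≥ 0` for `y ≥ 0`. [folklore] -/
theorem esymm_powersetCard_nonneg {y : ι → ℝ} (hy : ∀ j, 0 ≤ y j) (F : Finset ι) (n : ℕ) :
    0 ≤ ∑ S ∈ F.powersetCard n, ∏ j ∈ S, y j :=
  Finset.sum_nonneg fun _ _ => Finset.prod_nonneg fun j _ => hy j

/-- The recursion `e_{n+1}(F ∪ {a}) = e_{n+1}(F) + y_a e_n(F)` (`a ∉ F`). [folklore] -/
theorem esymm_powersetCard_insert_succ [DecidableEq ι] (y : ι → ℝ) {a : ι} {F : Finset ι}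
    (ha : a ∉ F) (n : ℕ) :
    ∑ S ∈ (insert a F).powersetCard (n + 1), ∏ j ∈ S, y j =
      ∑ S ∈ F.powersetCard (n + 1), ∏ j ∈ S, y j + y a * ∑ S ∈ F.powersetCard n, ∏ j ∈ S, y j := by
  rw [Finset.powersetCard_succ_insert ha, Finset.sum_union, Finset.sum_image]
  · rw [Finset.mul_sum]
    congr 1
    refine Finset.sum_congr rfl fun S hS => ?_
    have haS : a ∉ S := fun h => ha ((Finset.mem_powersetCard.1 hS).1 h)
    rw [Finset.prod_insert haS]
  · intro S hS T hT hST
    have haS : a ∉ S := fun h => ha ((Finset.mem_powersetCard.1 (Finset.mem_coe.1 hS)).1 h)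
    have haT : a ∉ T := fun h => ha ((Finset.mem_powersetCard.1 (Finset.mem_coe.1 hT)).1 h)
    rw [← Finset.erase_insert haS, hST, Finset.erase_insert haT]
  · rw [Finset.disjoint_left]
    intro S hS hS'
    obtain ⟨T, -, rfl⟩ := Finset.mem_image.1 hS'
    exact ha ((Finset.mem_powersetCard.1 hS).1 (Finset.mem_insert_self a T))

/-- The arithmetic of (A.11) one variable at a time: if `C ≥ 0` satisfies `C_{m+n} ≤ C_m C_n` and
`C'_0 = 1`, `C'_{k+1} = C_{k+1} + (k+1) t C_k` with `t ≥ 0` (the effect on `c_n = n! e_n` of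
adjoining one `y_a = t`), then `C'_{m+n} ≤ C'_m C'_n`. [folklore] -/
theorem submult_of_succ_eq {C C' : ℕ → ℝ} {t : ℝ} (ht : 0 ≤ t) (h0 : ∀ k, 0 ≤ C k)
    (hC : ∀ m n, C (m + n) ≤ C m * C n) (hC'0 : C' 0 = 1)
    (hsucc : ∀ k, C' (k + 1) = C (k + 1) + ((k : ℝ) + 1) * t * C k) :
    ∀ m n, C' (m + n) ≤ C' m * C' n := by
  intro m n
  cases m with
  | zero => rw [zero_add, hC'0, one_mul]
  | succ p =>
    cases n with
    | zero => rw [add_zero, hC'0, mul_one]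
    | succ q =>
      have e1 : p + 1 + (q + 1) = (p + q + 1) + 1 := by ring
      rw [e1, hsucc, hsucc, hsucc]
      have h1 : C (p + q + 1 + 1) ≤ C (p + 1) * C (q + 1) := by rw [← e1]; exact hC (p + 1) (q + 1)
      have h2 : C (p + q + 1) ≤ C (p + 1) * C q := by
        rw [show p + q + 1 = p + 1 + q by ring]; exact hC (p + 1) q
      have h3 : C (p + q + 1) ≤ C p * C (q + 1) := by
        rw [show p + q + 1 = p + (q + 1) by ring]; exact hC p (q + 1)
      have t2 : ((q : ℝ) + 1) * t * C (p + q + 1) ≤ ((q : ℝ) + 1) * t * (C (p + 1) * C q) :=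
        mul_le_mul_of_nonneg_left h2 (mul_nonneg (by positivity) ht)
      have t3 : ((p : ℝ) + 1) * t * C (p + q + 1) ≤ ((p : ℝ) + 1) * t * (C p * C (q + 1)) :=
        mul_le_mul_of_nonneg_left h3 (mul_nonneg (by positivity) ht)
      have t4 : 0 ≤ ((p : ℝ) + 1) * ((q : ℝ) + 1) * (t * t) * (C p * C q) :=
        mul_nonneg (mul_nonneg (by positivity) (mul_nonneg ht ht)) (mul_nonneg (h0 p) (h0 q))
      push_cast
      nlinarith [h1, t2, t3, t4]

/-- **(A.11): `c_{m+n} ≤ c_m c_n`** for the primed sums `c_n(F) = n! e_n(F)` of a finite family of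
`y_j ≥ 0` ("because the conditions of primed summations are weaker for the left hand side"; here
by induction on the family, `submult_of_succ_eq`). [cite: HaraHattoriWatanabe2001, Appendix A eq. (A.11)] -/
theorem factorial_mul_esymm_add_le {y : ι → ℝ} (hy : ∀ j, 0 ≤ y j) (F : Finset ι) :
    ∀ m n : ℕ, (((m + n).factorial : ℝ) * ∑ S ∈ F.powersetCard (m + n), ∏ j ∈ S, y j) ≤
      ((m.factorial : ℝ) * ∑ S ∈ F.powersetCard m, ∏ j ∈ S, y j) *
        ((n.factorial : ℝ) * ∑ S ∈ F.powersetCard n, ∏ j ∈ S, y j) := by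
  classical
  induction F using Finset.induction_on with
  | empty =>
    intro m n
    cases m with
    | zero => rw [zero_add, Nat.factorial_zero, Nat.cast_one, esymm_powersetCard_zero, one_mul, one_mul]
    | succ p =>
      rw [show p + 1 + n = (p + n) + 1 by ring, esymm_powersetCard_empty_succ,
        esymm_powersetCard_empty_succ, mul_zero, mul_zero, zero_mul]
  | insert a F ha ih =>
    refine submult_of_succ_eq (C := fun k => (k.factorial : ℝ) * ∑ S ∈ F.powersetCard k, ∏ j ∈ S, y j)
      (C' := fun k => (k.factorial : ℝ) * ∑ S ∈ (insert a F).powersetCard k, ∏ j ∈ S, y j)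
      (hy a) (fun k => mul_nonneg (Nat.cast_nonneg _) (esymm_powersetCard_nonneg hy F k)) ih ?_ ?_
    · rw [Nat.factorial_zero, Nat.cast_one, esymm_powersetCard_zero, one_mul]
    · intro k
      simp only [esymm_powersetCard_insert_succ y ha, Nat.factorial_succ, Nat.cast_mul,
        Nat.cast_succ]
      ring

end Esymm

/-! ### (A.8): Taylor coefficients of the product `∏_j (1 + y_j H²)` -/

section Analytic

variable {ι : Type*}

/-- (A.8) for a finite subfamily: `∏_{j ∈ F} (1 + y_j z²) = Σ_{S ⊆ F} (∏_{j∈S} y_j) z^{2#S}`.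
[cite: HaraHattoriWatanabe2001, Appendix A eq. (A.8)] -/
theorem prod_one_add_mul_sq (y : ι → ℝ) (F : Finset ι) (z : ℂ) :
    ∏ j ∈ F, (1 + (y j : ℂ) * z ^ 2) =
      ∑ S ∈ F.powerset, (∏ j ∈ S, (y j : ℂ)) * z ^ (2 * S.card) := by
  rw [Finset.prod_one_add]
  refine Finset.sum_congr rfl fun S _ => ?_
  rw [Finset.prod_mul_distrib, Finset.prod_const, ← pow_mul]

/-- (A.8)–(A.9) for a finite subfamily, as Taylor coefficients:
`(d/dz)^{2m} ∏_{j∈F}(1 + y_j z²) |_{z=0} = (2m)! e_m(F)` (`= (2m)!/m! · c_m(F)`).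
[cite: HaraHattoriWatanabe2001, Appendix A eqs. (A.8)–(A.9)] -/
theorem iteratedDeriv_prod_one_add_mul_sq (y : ι → ℝ) (F : Finset ι) (m : ℕ) :
    iteratedDeriv (2 * m) (fun z : ℂ => ∏ j ∈ F, (1 + (y j : ℂ) * z ^ 2)) 0 =
      ((2 * m).factorial : ℂ) * ((∑ S ∈ F.powersetCard m, ∏ j ∈ S, y j : ℝ) : ℂ) := by
  have hfun : (fun z : ℂ => ∏ j ∈ F, (1 + (y j : ℂ) * z ^ 2)) =
      fun z => ∑ S ∈ F.powerset, (∏ j ∈ S, (y j : ℂ)) * z ^ (2 * S.card) :=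
    funext (prod_one_add_mul_sq y F)
  rw [hfun, iteratedDeriv_fun_sum (fun S _ => by fun_prop)]
  simp only [iteratedDeriv_const_mul_field, iteratedDeriv_fun_pow_zero]
  rw [Finset.powersetCard_eq_filter]
  push_cast
  rw [Finset.sum_filter, Finset.mul_sum]
  refine Finset.sum_congr rfl fun S _ => ?_
  by_cases h : S.card = m
  · subst h
    simp [mul_comm]
  · have h' : 2 * m ≠ 2 * S.card := fun e => h (by omega)
    simp [h, h']

/-- The partial products `∏_{j∈F}(1 + y_j z²)` converge to `∏_j (1 + y_j z²)` locally uniformly on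
the unit disc (`y ≥ 0` summable). [folklore] -/
theorem tendstoLocallyUniformlyOn_prod_one_add_mul_sq {y : ι → ℝ} (hy0 : ∀ j, 0 ≤ y j)
    (hy : Summable y) :
    TendstoLocallyUniformlyOn (fun (F : Finset ι) (z : ℂ) => ∏ j ∈ F, (1 + (y j : ℂ) * z ^ 2))
      (fun z => ∏' j, (1 + (y j : ℂ) * z ^ 2)) atTop (Metric.ball (0 : ℂ) 1) := by
  have h := hy.hasProdLocallyUniformlyOn_one_add (f := fun j (z : ℂ) => (y j : ℂ) * z ^ 2)
    (K := Metric.ball (0 : ℂ) 1) Metric.isOpen_ball ?_ (fun j => by fun_prop)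
  · exact h
  · refine Eventually.of_forall fun j z hz => ?_
    rw [norm_mul, Complex.norm_real, Real.norm_of_nonneg (hy0 j), norm_pow]
    have hz1 : ‖z‖ ≤ 1 := (mem_ball_zero_iff.1 hz).le
    calc y j * ‖z‖ ^ 2 ≤ y j * 1 :=
          mul_le_mul_of_nonneg_left (pow_le_one₀ (norm_nonneg _) hz1) (hy0 j)
      _ = y j := mul_one _

/-- Locally uniform convergence of entire functions on an open set passes to all iterated
derivatives (Weierstrass). [folklore] -/
theorem tendstoLocallyUniformlyOn_iteratedDeriv {α : Type*} {l : Filter α} {G : α → ℂ → ℂ}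
    {g : ℂ → ℂ} {U : Set ℂ} (hU : IsOpen U) (hG : ∀ a, Differentiable ℂ (G a))
    (h : TendstoLocallyUniformlyOn G g l U) (k : ℕ) :
    TendstoLocallyUniformlyOn (fun a => iteratedDeriv k (G a)) (iteratedDeriv k g) l U := by
  induction k generalizing G g with
  | zero => simpa only [iteratedDeriv_zero] using h
  | succ k ih =>
    have h1 : TendstoLocallyUniformlyOn (deriv ∘ G) (deriv g) l U :=
      h.deriv (Eventually.of_forall fun a => (hG a).differentiableOn) hU
    have hG' : ∀ a, Differentiable ℂ (deriv (G a)) := fun a => by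
      have := ((hG a).contDiff).differentiable_iteratedDeriv' 1
      simpa only [iteratedDeriv_one] using this
    simpa only [iteratedDeriv_succ'] using ih hG' h1

/-- (A.8)–(A.9) in the limit: along finite subfamilies `F → ∞`,
`(2m)! e_m(F) → (d/dz)^{2m} ∏_j (1 + y_j z²) |_{z=0}`. [cite: HaraHattoriWatanabe2001, Appendix A eqs. (A.8)–(A.9)] -/
theorem tendsto_factorial_mul_esymm_iteratedDeriv {y : ι → ℝ} (hy0 : ∀ j, 0 ≤ y j) (hy : Summable y)
    (m : ℕ) :
    Tendsto (fun F : Finset ι =>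
      ((2 * m).factorial : ℂ) * ((∑ S ∈ F.powersetCard m, ∏ j ∈ S, y j : ℝ) : ℂ)) atTop
      (𝓝 (iteratedDeriv (2 * m) (fun z : ℂ => ∏' j, (1 + (y j : ℂ) * z ^ 2)) 0)) := by
  have h := (tendstoLocallyUniformlyOn_iteratedDeriv Metric.isOpen_ball (fun F => by fun_prop)
    (tendstoLocallyUniformlyOn_prod_one_add_mul_sq hy0 hy) (2 * m)).tendsto_at
    (Metric.mem_ball_self one_pos)
  simpa only [iteratedDeriv_prod_one_add_mul_sq] using h

/-- Moments from the moment generating function of a finite Dirac sum: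
`(d/dz)^k [Σ_i w_i e^{z x_i} / Z] |_{z=0} = Σ_i w_i x_i^k / Z`. [folklore] -/
theorem iteratedDeriv_expSum {κ : Type*} [Fintype κ] (w : κ → ℝ) (x : κ → ℝ) (Z : ℝ) (k : ℕ) :
    iteratedDeriv k (fun z : ℂ => (∑ i, (w i : ℂ) * Complex.exp (z * x i)) / Z) 0 =
      (∑ i, (w i : ℂ) * (x i : ℂ) ^ k) / Z := by
  simp only [iteratedDeriv_div_const]
  rw [iteratedDeriv_fun_sum (fun i _ => by fun_prop)]
  congr 1
  refine Finset.sum_congr rfl fun i _ => ?_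
  rw [iteratedDeriv_const_mul_field]
  have e : (fun z : ℂ => Complex.exp (z * x i)) = fun z => Complex.exp ((x i : ℂ) * z) := by
    funext z; rw [mul_comm]
  rw [e, iteratedDeriv_cexp_const_mul]
  simp

end Analytic

/-! ### (A.6) along the trajectory -/

/-- **Newman's bound (A.6) from a Gaussian-free product representation**: if
`∫ e^{zx} h_N(x)dx = ∏_j (1 + y_j z²)` with `y_j ≥ 0` summable, `h_N = R^N h_{I,s}` (any `c`), then
`a_{m+n} ≤ a_m a_n` for `a_n = n!/(2n)! ∫ x^{2n} h_N`. (Here `a_n = lim_F c_n(F)` and (A.11) passes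
to the limit; (A.10), (A.12) are vacuous since `b = 0`.)
[cite: HaraHattoriWatanabe2001, Appendix A, Proposition A.1 (proof, eqs. (A.7)–(A.12))] -/
theorem taylorA_iterate_add_le_of_repr {c s : ℝ} {N : ℕ} {ι : Type*} {y : ι → ℝ}
    (hy0 : ∀ j, 0 ≤ y j) (hy : Summable y)
    (hrepr : ∀ z : ℂ, ∫ x, Complex.exp (z * x) ∂((rgMap c)^[N] (IsingStrongCouplingLimit.isingLaw s)) =
      ∏' j, (1 + (y j : ℂ) * z ^ 2))
    (m n : ℕ) :
    taylorA ((rgMap c)^[N] (IsingStrongCouplingLimit.isingLaw s)) (m + n) ≤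
      taylorA ((rgMap c)^[N] (IsingStrongCouplingLimit.isingLaw s)) m *
        taylorA ((rgMap c)^[N] (IsingStrongCouplingLimit.isingLaw s)) n := by
  -- the two expressions of the moment generating function
  have hMP : (fun z : ℂ => (∑ σ, (isingWeight c s N σ : ℂ) * Complex.exp (z * blockVal c s N σ)) /
      partitionZ c s N) = fun z => ∏' j, (1 + (y j : ℂ) * z ^ 2) :=
    funext fun z => by rw [← integral_cexp_iterate_rgMap_isingLaw, hrepr z]
  -- `a_m = lim_F c_m(F)`, `c_m(F) = m! e_m(F)`
  have hlim : ∀ m : ℕ, Tendsto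
      (fun F : Finset ι => (m.factorial : ℝ) * ∑ S ∈ F.powersetCard m, ∏ j ∈ S, y j) atTop
      (𝓝 (taylorA ((rgMap c)^[N] (IsingStrongCouplingLimit.isingLaw s)) m)) := by
    intro m
    have h1 := tendsto_factorial_mul_esymm_iteratedDeriv hy0 hy m
    rw [← hMP, iteratedDeriv_expSum] at h1
    -- back to real numbers
    have h2 : Tendsto
        (fun F : Finset ι => ((2 * m).factorial : ℝ) * ∑ S ∈ F.powersetCard m, ∏ j ∈ S, y j) atTop
        (𝓝 ((∑ σ, isingWeight c s N σ * blockVal c s N σ ^ (2 * m)) / partitionZ c s N)) := by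
      have h3 := (Complex.continuous_re.tendsto _).comp h1
      have e1 : ∀ F : Finset ι, (((2 * m).factorial : ℂ) *
          ((∑ S ∈ F.powersetCard m, ∏ j ∈ S, y j : ℝ) : ℂ)).re =
          ((2 * m).factorial : ℝ) * ∑ S ∈ F.powersetCard m, ∏ j ∈ S, y j := fun F => by
        rw [← Complex.ofReal_natCast, ← Complex.ofReal_mul, Complex.ofReal_re]
      have e2 : ((∑ σ, (isingWeight c s N σ : ℂ) * (blockVal c s N σ : ℂ) ^ (2 * m)) /
          (partitionZ c s N : ℂ)).re =
          (∑ σ, isingWeight c s N σ * blockVal c s N σ ^ (2 * m)) / partitionZ c s N := by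
        rw [show (∑ σ, (isingWeight c s N σ : ℂ) * (blockVal c s N σ : ℂ) ^ (2 * m)) /
          (partitionZ c s N : ℂ) = (((∑ σ, isingWeight c s N σ * blockVal c s N σ ^ (2 * m)) /
            partitionZ c s N : ℝ) : ℂ) by push_cast; rfl, Complex.ofReal_re]
      have h4 : (Complex.re ∘ fun F : Finset ι => ((2 * m).factorial : ℂ) *
          ((∑ S ∈ F.powersetCard m, ∏ j ∈ S, y j : ℝ) : ℂ)) =
          fun F => ((2 * m).factorial : ℝ) * ∑ S ∈ F.powersetCard m, ∏ j ∈ S, y j :=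
        funext fun F => e1 F
      rw [h4, e2] at h3
      exact h3
    have hmom : moment id (2 * m) ((rgMap c)^[N] (IsingStrongCouplingLimit.isingLaw s)) =
        (∑ σ, isingWeight c s N σ * blockVal c s N σ ^ (2 * m)) / partitionZ c s N := by
      rw [moment_id_eq, integral_iterate_rgMap_isingLaw, smul_eq_mul, div_eq_inv_mul]
      simp only [smul_eq_mul]
    have h5 := h2.const_mul ((m.factorial : ℝ) / (2 * m).factorial)
    rw [← hmom] at h5
    refine h5.congr fun F => ?_
    have hf : ((2 * m).factorial : ℝ) ≠ 0 := Nat.cast_ne_zero.2 (Nat.factorial_ne_zero _)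
    field_simp
  exact le_of_tendsto_of_tendsto' (hlim (m + n)) ((hlim m).mul (hlim n))
    fun F => factorial_mul_esymm_add_le hy0 F m n

/-- **(A.6) for `h_N = R^N h_{I,s}`, every `0 < c ≤ 2`, `s ≥ 0`**: `a_{m+n,N} ≤ a_{m,N} a_{n,N}`
(`a_{n,N} = taylorA h_N n`), from `exists_newmanRepr_iterate` (b = 0) and
`taylorA_iterate_add_le_of_repr`. [cite: HaraHattoriWatanabe2001, Appendix A, Proposition A.1 eq. (A.6)] -/
theorem taylorA_iterate_add_le (c s : ℝ) (hc : 0 < c) (hc2 : c ≤ 2) (hs : 0 ≤ s) (N m n : ℕ) :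
    taylorA ((rgMap c)^[N] (IsingStrongCouplingLimit.isingLaw s)) (m + n) ≤
      taylorA ((rgMap c)^[N] (IsingStrongCouplingLimit.isingLaw s)) m *
        taylorA ((rgMap c)^[N] (IsingStrongCouplingLimit.isingLaw s)) n := by
  obtain ⟨ι, α, hα, hsum, hrepr⟩ := exists_newmanRepr_iterate
    Literature.Analysis.Complex.hadamard_genus_zero_holds c s hc hc2 hs N
  refine taylorA_iterate_add_le_of_repr (y := fun j => (α j ^ 2)⁻¹) (fun j => by positivity) hsum
    (fun z => ?_) m n
  rw [hrepr z]
  refine tprod_congr fun j => ?_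
  have hαj : (α j : ℂ) ≠ 0 := Complex.ofReal_ne_zero.2 (hα j).ne'
  push_cast
  field_simp

end HierarchicalRG

open HierarchicalRG in
/-- **HHW Appendix A, Proposition A.1, eq. (A.6) — the named fact `HaraHattoriWatanabe2001_eqA6`,
PROVED** (`d = 4`, `c = √2`, every `s ≥ 0`, `N`, `m`, `n`): `a_{m+n,N} ≤ a_{m,N} a_{n,N}`.
[cite: HaraHattoriWatanabe2001, Appendix A, Proposition A.1 eq. (A.6)] [cite: Newman1975, Theorem 6] -/
theorem HaraHattoriWatanabe2001_eqA6_holds : HaraHattoriWatanabe2001_eqA6 := by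
  intro s hs N m n
  exact taylorA_iterate_add_le (Real.sqrt 2) s (Real.sqrt_pos.2 two_pos) sqrt_two_le_two hs N m n

end Literature.Barriers.CriticalPhenomena

end
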